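import Summits.QuantumAdvantage.AdviceFreeQNC0.ColumnTest
import Summits.QuantumAdvantage.AdviceFreeQNC0.MassInequalityRegimesProofs
import HarnessLib

/-!
# Cell qa-qnc0 (rung F-Q1, density axis, crux of record `TensorMultOneAt`): the TRANSPORT FORM of (★) —
# `TransportOfAll m` and `StarOfTransport m` for every `m` (planner qa-qnc0-p1 gen 14, Sketch14 §Transport,
# ask P20)

Planner qa-qnc0-p1 ROUND-13 §1.3′ (`HOME/qa-qnc0-p1/ROUND-13.md`, `Sketch14.lean` §Transport).  Statements
VERBATIM from Sketch14 §Transport: `IsReduced`, `TransportFor`, `TransportCert` ((★-T)), `TransportAll`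
((★-T⁺)), `TransportOfAll`, `StarOfTransport`, `TransportFifteen` (conjecture of record for the rank-1 slice
at `m = 15`), `OneWordMIFifteenChain` (+ its one-line proof).  PROVED here:

* **`transportOfAll : ∀ m, TransportOfAll m`** — (★-T⁺) ⇒ (★-T): for a REDUCED outside set `E` inside the
  window `2|E| ≤ |Z|` use the hypothesis; above the window the constant `n ≡ 1/2` is a transport: its mass
  is `|Z|/2 ≤ |E|`, and for every codeword `Y` reducedness `2|E ∩ Y_Out| ≤ b_Y` gives
  `2|E ∩ Y_Out| − (b_Y − a_Y) ≤ a_Y = 2·n(Y ∩ Z)`.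
* **`starOfTransport : ∀ m, StarOfTransport m`** — (★-T) ⇒ (★): given the outside word `s`, choose a
  codeword `A` minimising the outside mismatch `#{u ∈ Out : A u ≠ s u}` (`Finset.exists_min_image` over the
  finite set of codewords, nonempty by `0 ∈ C_m`); the mismatch set `E := {u ∈ Out : A u ≠ s u}` is REDUCED
  by minimality against `A ⊕ Y` (the COUNT IDENTITY
  `#{Out : (A⊕Y) ≠ s} + 2|E ∩ Y| = |E| + b_Y`, `TransportProofs.count_identity`); take a transport `n` for
  `E` and put `q z := if A z then 1 − n z else n z`; against a codeword `X`, with `Y := X ⊕ A ∈ C_m`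
  (`isElim1_xor`), pointwise `|X z − q z| = [Y z] + n z − 2[Y z]·n z` (`TransportProofs.abs_point`), so the
  column test reads `a_Y + n(Z) − 2n(Y∩Z) ≤ |E| + b_Y − 2|E ∩ Y_Out|` — the sum of the two transport
  inequalities `n(Z) ≤ |E|` and `2|E ∩ Y_Out| − (b_Y − a_Y) ≤ 2n(Y∩Z)`.
* `oneWordMI_fifteen_of_transport` — with the LANDED `relMIOfStar`, `oneWordOfRelMI` (`ColumnTest.lean`,
  qn-prover g8) and `oneWordDecode` (`MassInequalityRegimesProofs.lean`, qn-lit g12): ONE-WORD MI(15) at the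
  symmetric optima consumes exactly `TransportFifteen`.

The cell's lemmas (not in print).  WHAT THIS IS NOT: `TransportFifteen` / (★) at `m = 14, 15` is OPEN
(kit evidence only: j280819/j280823/j281031); nothing on `MassIneqAll`, MULT₁ or α; separation NOT moved.
-/

noncomputable section

namespace Summit.QuantumAdvantage.AdviceFreeQNC0

open Finset
open Literature.Computability.MetaComplexity Literature.Computability.MetaComplexity.Smolensky

namespace MassInequality

/-! ### Sketch14 §Transport — statements VERBATIM -/
section Transport

/-- `E` is a REDUCED outside set for `K0`: `E ⊆ Out(K0)` and `0` is a nearest codeword to `1_E`, i.e.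
`2·|E ∩ Y_Out| ≤ b_Y` for every codeword `Y`.  (Sketch14, verbatim.) -/
def IsReduced (m : ℕ) (K0 E : (Fin m → Bool) → Bool) : Prop :=
  (∀ u, E u = true → K0 u = true) ∧
  ∀ Y, IsElim1 m Y →
    2 * (univ.filter fun u : Fin m → Bool => E u = true ∧ Y u = true ∧ K0 u = true).card ≤ outCount K0 Y

/-- `n` is a TRANSPORT for `E`: `n : Z(K0) → [0,1]`, total mass `≤ |E|`, and for every codeword `Y`:
`2·n(Y ∩ Z) ≥ 2·|E ∩ Y_Out| − (b_Y − a_Y)`.  (Sketch14, verbatim.) -/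
def TransportFor (m : ℕ) (K0 E : (Fin m → Bool) → Bool) (n : (Fin m → Bool) → ℚ) : Prop :=
  (∀ z, K0 z = false → 0 ≤ n z ∧ n z ≤ 1) ∧
  (∑ z ∈ univ.filter (fun z : Fin m → Bool => K0 z = false), n z) ≤
      ((univ.filter fun u : Fin m → Bool => E u = true).card : ℚ) ∧
  ∀ Y, IsElim1 m Y →
    2 * ((univ.filter fun u : Fin m → Bool => E u = true ∧ Y u = true ∧ K0 u = true).card : ℚ)
        - ((outCount K0 Y : ℚ) - (inCount K0 Y : ℚ)) ≤
      2 * (∑ z ∈ univ.filter (fun z : Fin m → Bool => K0 z = false ∧ Y z = true), n z)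

/-- **(★-T)(m,K0)** — every REDUCED outside set admits a transport.  Equivalent to `StarCert m K0` (below: the
useful direction).  (Sketch14, verbatim.) -/
def TransportCert (m : ℕ) (K0 : (Fin m → Bool) → Bool) : Prop :=
  ∀ E, IsReduced m K0 E → ∃ n, TransportFor m K0 E n

/-- **(★-T⁺)(m,K0)** — UNREDUCED transport in the window: every `E ⊆ Out` with `2|E| ≤ |Z|` admits a transport
(reducedness dropped; for `2|E| ≥ |Z|` and reduced `E` the constant `n ≡ 1/2` is a transport).  Equivalent (Farkas)
to the LOAD CRITERION `top_e(M_λ) ≤ top_e(L_λ) + ½⟨λ, σ⟩` for all `λ ≥ 0` on codewords, `e ≤ |Z|/2` — a statement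
about the code alone.  Kit evidence at m = 15 (j281031, j280819/j280823).  (Sketch14, verbatim.) -/
def TransportAll (m : ℕ) (K0 : (Fin m → Bool) → Bool) : Prop :=
  ∀ E : (Fin m → Bool) → Bool, (∀ u, E u = true → K0 u = true) →
    2 * (univ.filter fun u : Fin m → Bool => E u = true).card ≤ (univ.filter fun z : Fin m → Bool => K0 z = false).card →
    ∃ n, TransportFor m K0 E n

/-- support (S): (★-T⁺) ⇒ (★-T) — in the window use the hypothesis, above it `n ≡ 1/2` (uses reducedness
`2|E∩Y_Out| ≤ b_Y`).  (Sketch14, verbatim; proved below.) -/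
def TransportOfAll (m : ℕ) : Prop := ∀ K0 : (Fin m → Bool) → Bool, TransportAll m K0 → TransportCert m K0

/-- support (M): (★-T) ⇒ (★).  Given `s`, choose `A ∈ C_m` minimising `#{u ∈ Out : A u ≠ s u}`, put
`E u := (K0 u ∧ A u ≠ s u)` (reduced by minimality), take a transport `n`, and set `q z := if A z then 1 − n z else n z`;
the test against `X` is the transport inequality for `Y = X ⊕ A`.  (Sketch14, verbatim; proved below.) -/
def StarOfTransport (m : ℕ) : Prop := ∀ K0 : (Fin m → Bool) → Bool, TransportCert m K0 → StarCert m K0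

/-- **CONJECTURE OF RECORD for the rank-1 slice at m = 15** (qn-p1 g14): unreduced transport at the symmetric optimum.
Chain: `TransportFifteen → TransportOfAll 15 → StarOfTransport 15 → RelMIOfStar 15 → OneWordOfRelMI 15 → OneWordMIAt 15 K0`.
OPEN (kit evidence only).  (Sketch14, verbatim.) -/
def TransportFifteen : Prop :=
  ∀ K0 : (Fin 15 → Bool) → Bool, IsOpt1 15 K0 → IsSymPat K0 → TransportAll 15 K0

/-- The rank-1 chain at m = 15 assembled (all links are the defs above).  (Sketch14, verbatim.) -/
def OneWordMIFifteenChain : Prop :=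
  TransportFifteen → TransportOfAll 15 → StarOfTransport 15 → RelMIOfStar 15 → OneWordDecode 15 → OneWordOfRelMI 15 →
    ∀ K0 : (Fin 15 → Bool) → Bool, IsOpt1 15 K0 → IsSymPat K0 → OneWordMIAt 15 K0

/-- (Sketch14, verbatim.) -/
theorem oneWordMIFifteenChain : OneWordMIFifteenChain := by
  intro hT hA hS hR hD hO K0 ho hs
  exact hO K0 hD (hR K0 (hS K0 (hA K0 (hT K0 ho hs))))

end Transport

end MassInequality

open MassInequality

/-! ### `TransportOfAll` -/

/-- **`TransportOfAll m` for every `m` — PROVED**: inside the window the hypothesis, above it `n ≡ 1/2`. -/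
theorem transportOfAll (m : ℕ) : TransportOfAll m := by
  classical
  intro K0 hAll E hred
  by_cases hw : 2 * (univ.filter fun u : Fin m → Bool => E u = true).card ≤
      (univ.filter fun z : Fin m → Bool => K0 z = false).card
  · exact hAll E hred.1 hw
  · push Not at hw
    refine ⟨fun _ => 1 / 2, fun z _ => by norm_num, ?_, fun Y hY => ?_⟩
    · rw [Finset.sum_const, nsmul_eq_mul]
      have h : (((univ.filter fun z : Fin m → Bool => K0 z = false).card : ℕ) : ℚ) <
          2 * ((univ.filter fun u : Fin m → Bool => E u = true).card : ℚ) := by exact_mod_cast hw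
      linarith
    · have hr : (2 : ℚ) * ((univ.filter fun u : Fin m → Bool => E u = true ∧ Y u = true ∧ K0 u = true).card : ℚ)
          ≤ (MassInequality.outCount K0 Y : ℚ) := by exact_mod_cast hred.2 Y hY
      have hc : (((univ.filter fun z : Fin m → Bool => K0 z = false ∧ Y z = true).card : ℕ) : ℚ) =
          (MassInequality.inCount K0 Y : ℚ) := by
        unfold MassInequality.inCount
        rw [Finset.filter_congr (fun u _ => and_comm)]
      rw [Finset.sum_const, nsmul_eq_mul]
      linarith

/-! ### `StarOfTransport` -/

namespace TransportProofs

variable {m : ℕ}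

/-- Pointwise form of the column test after translation by `A`: for `q = if a then 1 − n else n` and
`y = x ⊕ a`, `|x − q| = [y] + n − 2[y]·n` (`0 ≤ n ≤ 1`). -/
theorem abs_point (x a : Bool) {n : ℚ} (h0 : 0 ≤ n) (h1 : n ≤ 1) :
    |bq x - (if a = true then 1 - n else n)| = bq (xor x a) + n - 2 * (bq (xor x a) * n) := by
  have hbt : bq true = 1 := rfl
  have hbf : bq false = 0 := rfl
  cases x <;> cases a
  · -- `x = false`, `a = false`, `y = false`
    rw [if_neg Bool.false_ne_true, Bool.false_xor, hbf, zero_sub, abs_neg, abs_of_nonneg h0]; ring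
  · -- `x = false`, `a = true`, `y = true`
    rw [if_pos rfl, Bool.false_xor, hbt, hbf, zero_sub, abs_neg, abs_of_nonneg (by linarith)]; ring
  · -- `x = true`, `a = false`, `y = true`
    rw [if_neg Bool.false_ne_true, Bool.true_xor, Bool.not_false, hbt, abs_of_nonneg (by linarith)]; ring
  · -- `x = true`, `a = true`, `y = false`
    rw [if_pos rfl, Bool.true_xor, Bool.not_true, hbt, hbf, sub_sub_cancel, abs_of_nonneg h0]; ring

/-- THE COUNT IDENTITY behind reducedness and the column test: with `E = {u ∈ Out : A u ≠ s u}` and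
`Y = X ⊕ A`, `#{u ∈ Out : X u ≠ s u} + 2·|E ∩ Y ∩ Out| = |E| + b_Y`. -/
theorem count_identity (K0 A s X Y E : (Fin m → Bool) → Bool)
    (hE : E = fun u => decide (K0 u = true ∧ A u ≠ s u)) (hY : ∀ u, Y u = xor (X u) (A u)) :
    (univ.filter fun u : Fin m → Bool => K0 u = true ∧ X u ≠ s u).card +
        2 * (univ.filter fun u : Fin m → Bool => E u = true ∧ Y u = true ∧ K0 u = true).card =
      (univ.filter fun u : Fin m → Bool => E u = true).card + MassInequality.outCount K0 Y := by
  classical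
  subst hE
  unfold MassInequality.outCount
  simp only [Finset.card_filter, Finset.mul_sum, ← Finset.sum_add_distrib]
  refine Finset.sum_congr rfl fun u _ => ?_
  rw [hY u]
  cases K0 u <;> cases X u <;> cases A u <;> cases s u <;> simp

/-- `#{u ∈ Out : A u ≠ s u} = |E|`. -/
theorem card_mismatch_eq (K0 A s E : (Fin m → Bool) → Bool)
    (hE : E = fun u => decide (K0 u = true ∧ A u ≠ s u)) :
    (univ.filter fun u : Fin m → Bool => K0 u = true ∧ A u ≠ s u).card =
      (univ.filter fun u : Fin m → Bool => E u = true).card := by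
  classical
  subst hE
  exact congrArg Finset.card (Finset.filter_congr fun u _ => by simp)

/-- The inside sum of the translated certificate: `Σ_{z ∈ Z} |X z − q z| = a_Y + n(Z) − 2·n(Y ∩ Z)`. -/
theorem inside_sum (K0 A X Y : (Fin m → Bool) → Bool) (n : (Fin m → Bool) → ℚ)
    (hn : ∀ z, K0 z = false → 0 ≤ n z ∧ n z ≤ 1) (hY : ∀ u, Y u = xor (X u) (A u)) :
    (∑ z ∈ univ.filter (fun z : Fin m → Bool => K0 z = false),
        |bq (X z) - (if A z = true then 1 - n z else n z)|) =
      (MassInequality.inCount K0 Y : ℚ) + (∑ z ∈ univ.filter (fun z : Fin m → Bool => K0 z = false), n z) -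
        2 * (∑ z ∈ univ.filter (fun z : Fin m → Bool => K0 z = false ∧ Y z = true), n z) := by
  classical
  -- pointwise rewriting on `Z`
  have h1 : (∑ z ∈ univ.filter (fun z : Fin m → Bool => K0 z = false),
      |bq (X z) - (if A z = true then 1 - n z else n z)|) =
      ∑ z ∈ univ.filter (fun z : Fin m → Bool => K0 z = false),
        (bq (Y z) + n z - 2 * (bq (Y z) * n z)) := by
    refine Finset.sum_congr rfl fun z hz => ?_
    have hz' : K0 z = false := (Finset.mem_filter.1 hz).2
    obtain ⟨h0, h1⟩ := hn z hz'
    rw [abs_point (X z) (A z) h0 h1, hY z]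
  -- the three pieces
  have h2 : (∑ z ∈ univ.filter (fun z : Fin m → Bool => K0 z = false), bq (Y z)) = (MassInequality.inCount K0 Y : ℚ) := by
    unfold MassInequality.inCount
    rw [Finset.natCast_card_filter, Finset.sum_filter]
    refine Finset.sum_congr rfl fun u _ => ?_
    cases K0 u <;> cases Y u <;> simp [bq]
  have h3 : (∑ z ∈ univ.filter (fun z : Fin m → Bool => K0 z = false), bq (Y z) * n z) =
      ∑ z ∈ univ.filter (fun z : Fin m → Bool => K0 z = false ∧ Y z = true), n z := by
    rw [Finset.sum_filter, Finset.sum_filter]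
    refine Finset.sum_congr rfl fun u _ => ?_
    cases K0 u <;> cases Y u <;> simp [bq]
  rw [h1, Finset.sum_sub_distrib, Finset.sum_add_distrib, ← Finset.mul_sum, h2, h3]

end TransportProofs

open TransportProofs

/-- **`StarOfTransport m` for every `m` — PROVED** ((★-T) ⇒ (★): nearest codeword `A`, reduced mismatch set `E`,
transport `n`, certificate `q = A|_Z ⊕ n`; see the module docstring). -/
theorem starOfTransport (m : ℕ) : StarOfTransport m := by
  classical
  intro K0 hT s
  -- a codeword `A` minimising the outside mismatch with `s`
  set CW : Finset ((Fin m → Bool) → Bool) := univ.filter fun B => IsElim1 m B with hCW_def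
  set f : ((Fin m → Bool) → Bool) → ℕ :=
    fun B => (univ.filter fun u : Fin m → Bool => K0 u = true ∧ B u ≠ s u).card with hf_def
  have hCWne : CW.Nonempty :=
    ⟨fun _ => false, Finset.mem_filter.2 ⟨Finset.mem_univ _, isElim1_false m⟩⟩
  obtain ⟨A, hACW, hmin⟩ := Finset.exists_min_image CW f hCWne
  have hA : IsElim1 m A := (Finset.mem_filter.1 hACW).2
  -- the mismatch set `E`, reduced by minimality
  obtain ⟨E, hE_def⟩ : ∃ E : (Fin m → Bool) → Bool, E = fun u => decide (K0 u = true ∧ A u ≠ s u) :=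
    ⟨_, rfl⟩
  have hEout : ∀ u, E u = true → K0 u = true := by
    intro u hu
    rw [hE_def] at hu
    exact ((decide_eq_true_iff).1 hu).1
  have hfA : f A = (univ.filter fun u : Fin m → Bool => E u = true).card := card_mismatch_eq K0 A s E hE_def
  have hred : IsReduced m K0 E := by
    refine ⟨hEout, fun Y hY => ?_⟩
    -- compare `A` with the codeword `A ⊕ Y`
    have hBY : ∀ u, Y u = xor (xor (A u) (Y u)) (A u) := fun u => by
      cases A u <;> cases Y u <;> rfl
    have hid := count_identity K0 A s (fun u => xor (A u) (Y u)) Y E hE_def hBY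
    have hle : f A ≤ f (fun u => xor (A u) (Y u)) :=
      hmin _ (Finset.mem_filter.2 ⟨Finset.mem_univ _, isElim1_xor hA hY⟩)
    simp only [hf_def] at hle hfA
    omega
  -- a transport for `E` and the certificate `q = A|_Z ⊕ n`
  obtain ⟨n, hn01, hnZ, hnY⟩ := hT E hred
  refine ⟨fun z => if A z = true then 1 - n z else n z, fun z hz => ?_, fun X hX => ?_⟩
  · obtain ⟨h0, h1⟩ := hn01 z hz
    show 0 ≤ (if A z = true then 1 - n z else n z) ∧ (if A z = true then 1 - n z else n z) ≤ 1
    by_cases hAz : A z = true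
    · rw [if_pos hAz]; constructor <;> linarith
    · rw [if_neg hAz]; exact ⟨h0, h1⟩
  · -- the test against `X` is the transport inequality at `Y = X ⊕ A`
    dsimp only
    obtain ⟨Y, hY_def⟩ : ∃ Y : (Fin m → Bool) → Bool, Y = fun u => xor (X u) (A u) := ⟨_, rfl⟩
    have hYu : ∀ u, Y u = xor (X u) (A u) := fun u => by rw [hY_def]
    have hYcw : IsElim1 m Y := by rw [hY_def]; exact isElim1_xor hX hA
    have hid : ((univ.filter fun u : Fin m → Bool => K0 u = true ∧ X u ≠ s u).card : ℚ) +
        2 * ((univ.filter fun u : Fin m → Bool => E u = true ∧ Y u = true ∧ K0 u = true).card : ℚ) =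
        ((univ.filter fun u : Fin m → Bool => E u = true).card : ℚ) + (MassInequality.outCount K0 Y : ℚ) := by
      exact_mod_cast count_identity K0 A s X Y E hE_def hYu
    have hins := inside_sum K0 A X Y n hn01 hYu
    have htr := hnY Y hYcw
    rw [hins]
    linarith

/-! ### The rank-1 slice at `m = 15` -/

/-- **ONE-WORD MI(15) consumes exactly `TransportFifteen`**: with `transportOfAll`, `starOfTransport`, the landed
`relMIOfStar`, `oneWordOfRelMI` (qn-prover g8) and `oneWordDecode` (qn-lit g12), the planner's chain
`oneWordMIFifteenChain` has every link but the first discharged. -/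
theorem oneWordMI_fifteen_of_transport (hT : TransportFifteen) :
    ∀ K0 : (Fin 15 → Bool) → Bool, IsOpt1 15 K0 → IsSymPat K0 → OneWordMIAt 15 K0 :=
  oneWordMIFifteenChain hT (transportOfAll 15) (starOfTransport 15) (relMIOfStar 15) (oneWordDecode 15)
    (oneWordOfRelMI 15)

/-- The same for every `m` and every `K0` (no optimality / symmetry needed): unreduced transport in the window
gives ONE-WORD MI at `K0`. -/
theorem oneWordMIAt_of_transportAll {m : ℕ} (K0 : (Fin m → Bool) → Bool) (hT : TransportAll m K0) :
    OneWordMIAt m K0 :=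
  oneWordOfRelMI m K0 (oneWordDecode m) (relMIOfStar m K0 (starOfTransport m K0 (transportOfAll m K0 hT)))

end Summit.QuantumAdvantage.AdviceFreeQNC0
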